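import Summits.ResolutionOfSingularities.ResolutionOfSingularities.Theorems.MarkedTransferCampaignW46ThreadChainExceptionalStep
import Summits.ResolutionOfSingularities.ResolutionOfSingularities.Theorems.MarkedTransferCampaignW46ThreadChainValuation
import HarnessLib

/-!
# [OURS · L1 W4.6 rung (i-a)] Thread chains, VI: the exceptional end game — normal crossings of the young prime
# divisors, extinction of the old ones, the monomial phase and its descent
# (cell res-hironaka, LADDER-RESOLUTION rung L, D-0089; campaign s46, prover res-L1-s46-pv-1; host route MarkedTransfer,
# `--supports stmt-ResolutionOfSingularities-16155`)

HONEST FRAMING. Nothing here is a statement of H. Hironaka's manuscript (2017-03-23, [Hironaka2017]). Pure commutative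
algebra inside a field `F` about the thread chains `IsThreadChain b R J` of `MarkedTransferCampaignW46ThreadChain.lean`
(companions `…Valuation`, `…Step`, `…Divisors`, `…ExceptionalStep`). AI review is weaker than expert review. No `sorry`.

## Contents

* `exists_span_mul_eq_extIdeal_of_le` — the cumulative transform law `P · J k = J N · R k` (`N ≤ k`).
* `exists_rsop_young` — **normal crossings of the young prime divisors**: for `k ≥ N`, a regular system of parameters
  `(ξ, η)` of `R k` such that every prime divisor `(R k)_{(π)}` dominating `R N` is `(R k)_{(ξ)}` or `(R k)_{(η)}`
  (induction along the chain with `inv_step_of_le`).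
* `exists_monomial` — **the monomial phase**: if for every prime element `π` of every `R N` the chain eventually leaves
  the prime divisor `(R N)_{(π)}` (no curve is followed forever), then for some `K` the ideal `J K` is `(ξ^α η^β)` for a
  regular system of parameters `(ξ, η)` of `R K` (principalization, extinction of the old prime divisors through the
  maximality of prime divisors, and `exists_rsop_young`).
* `false_of_monomial` — **descent**: `J K = (ξ^α η^β)` is impossible in a thread chain: the singular and isolated
  conditions give `α, β < b ≤ α + β`, and `mono_step_of_le` reproduces the monomial form at `K + 1` with smaller `α + β`.
* `false_of_forall_exists_not_le` — **the exceptional end game**: a thread chain which follows no curve forever is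
  impossible. (The followed-curve case is `MarkedTransferCampaignW46ThreadChainFollowed.lean`.)

## References

* O. Zariski, P. Samuel, *Commutative Algebra* II (1960), Appendix 5 (infinitely near points, proximity). [ZariskiSamuel1960]
* C. Huneke, I. Swanson, *Integral Closure of Ideals, Rings, and Modules* (2006), Ch. 14. [HunekeSwanson2006]
-/

noncomputable section

set_option linter.dupNamespace false -- mandated namespace of this single-conjunct summit

open IsLocalRing

namespace Summit.ResolutionOfSingularities.ResolutionOfSingularities.Theorems

namespace CampaignW46

open Literature.AlgebraicGeometry.Resolution

universe u

variable {F : Type u} [Field F]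

namespace IsThreadChain

variable {b : ℕ} {R : ℕ → Subring F} {J : ∀ k, Ideal (R k)} (h : IsThreadChain b R J)
include h

/-! ## The cumulative transform law from an arbitrary stage -/

/-- `P · J k = J N · R k` for some non-zero `P ∈ R k` (`N ≤ k`). [folklore] -/
theorem exists_span_mul_eq_extIdeal_of_le {N : ℕ} : ∀ {k : ℕ}, N ≤ k →
    ∃ P : R k, P ≠ 0 ∧ Ideal.span {P} * J k = extIdeal (J N) (R k) := by
  intro k hNk
  induction k, hNk using Nat.le_induction with
  | base => exact ⟨1, one_ne_zero, by rw [Ideal.span_singleton_one, Ideal.top_mul, extIdeal_self]⟩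
  | succ k hNk ih =>
    obtain ⟨P, hP0, hP⟩ := ih
    obtain ⟨x, hxR, hx0, -, -, hx1, hmx⟩ := h.exists_generator k
    have hprod := h.span_pow_mul_eq k hx1 hmx
    refine ⟨Subring.inclusion (h.le_succ k) P * (⟨x, hx1⟩ : R (k + 1)) ^ b, ?_, ?_⟩
    · refine mul_ne_zero ?_ (pow_ne_zero _ fun e => hx0 (congrArg Subtype.val e))
      exact fun e => hP0 (Subring.inclusion_injective _ (by rw [e, map_zero]))
    · rw [← Ideal.span_singleton_mul_span_singleton, mul_assoc, hprod, extIdeal_eq_map _ (h.le_succ k),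
        ← map_extIdeal (J N) (h.mono hNk) (h.le_succ k), ← hP, Ideal.map_mul, Ideal.map_span,
        Set.image_singleton]

/-! ## The normal-crossings invariant of the young prime divisors -/

/-- **The young prime divisors form normal crossings.** For every `k ≥ N` there is a regular system of parameters
`(ξ, η)` of `R k` such that every prime divisor `(R k)_{(π)}` DOMINATING `R N` (i.e. created after stage `N`) is
`(R k)_{(ξ)}` or `(R k)_{(η)}`: induction along the chain with `inv_step_of_le`; at `k = N` no prime divisor of `R N`
dominates `R N`. [cite: ZariskiSamuel1960, Appendix 5] -/
theorem exists_rsop_young (N : ℕ) : ∀ k, N ≤ k → ∃ ξ η : R k,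
    (haveI := (h.isRegularLocalRing k).toIsLocalRing; maximalIdeal (R k)) = Ideal.span {ξ, η} ∧
    ∀ (π : R k) (hπ : Prime π), (haveI := isPrime_span_of_prime hπ;
      SubringDominates (R N) (LocalSubring.ofPrime (R k) (Ideal.span {π})).toSubring) →
      Ideal.span {π} = Ideal.span {ξ} ∨ Ideal.span {π} = Ideal.span {η} := by
  obtain ⟨O, hO⟩ := h.exists_valuationSubring
  intro k hNk
  induction k, hNk using Nat.le_induction with
  | base =>
    haveI := h.isRegularLocalRing N
    obtain ⟨ξ, η, hm, -⟩ := exists_maximalIdeal_eq_span_pair (h.ringKrullDim_eq_two N)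
    refine ⟨ξ, η, hm, fun π hπ hdom => ?_⟩
    exfalso
    haveI := isPrime_span_of_prime hπ
    -- some `z ∈ 𝔪_N` is prime to `π`; it is a unit of `(R N)_{(π)}` but not of `R N`
    have hne : Ideal.span {π} ≠ maximalIdeal (R N) := (maximalIdeal_ne_span_singleton (h.ringKrullDim_eq_two N) π).symm
    have hπm : π ∈ maximalIdeal (R N) := by
      rw [mem_maximalIdeal, mem_nonunits_iff]; exact hπ.not_unit
    obtain ⟨z, hzm, hzπ⟩ : ∃ z ∈ maximalIdeal (R N), z ∉ Ideal.span {π} := by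
      by_contra hall
      push Not at hall
      exact hne (le_antisymm ((Ideal.span_singleton_le_iff_mem _).mpr hπm) hall)
    have hz0 : z ≠ 0 := by rintro rfl; exact hzπ (Ideal.zero_mem _)
    have hzinv : (z : F)⁻¹ ∈ (LocalSubring.ofPrime (R N) (Ideal.span {π})).toSubring := by
      by_contra hni
      exact hzπ (Ideal.mem_span_singleton.mpr ((not_inv_mem_ofPrime_span_iff_dvd hπ hz0).mp hni))
    have := hdom.2 (z : F) z.2 hzinv
    rcases (mem_maximalIdeal_iff_inv_not_mem z).mp hzm with hz | hz
    · exact hz0 (Subtype.ext hz)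
    · exact hz this
  | succ k hNk ih =>
    haveI := h.isRegularLocalRing k
    haveI := h.isRegularLocalRing (k + 1)
    obtain ⟨ξ, η, hm, hinv⟩ := ih
    have hst := h.along hO k
    rcases le_total (O.valuation (η : F)) (O.valuation (ξ : F)) with hle | hle
    · obtain ⟨hξ1, η', hm₁, -, hinv₁⟩ := inv_step_of_le (R₀ := R N) (h.ringKrullDim_eq_two k)
        (h.ringKrullDim_eq_two (k + 1)) (h.isLocalRingOf' k) hst (hO k) (hO (k + 1)) hm hle hinv
      exact ⟨⟨ξ, hξ1⟩, η', hm₁, hinv₁⟩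
    · have hm' : maximalIdeal (R k) = Ideal.span {η, ξ} := hm.trans Ideal.span_pair_comm
      obtain ⟨hη1, ξ', hm₁, -, hinv₁⟩ := inv_step_of_le (R₀ := R N) (h.ringKrullDim_eq_two k)
        (h.ringKrullDim_eq_two (k + 1)) (h.isLocalRingOf' k) hst (hO k) (hO (k + 1)) hm' hle
        (fun π hπ hd => (hinv π hπ hd).symm)
      exact ⟨⟨η, hη1⟩, ξ', hm₁, hinv₁⟩

/-! ## Extinction of the old prime divisors and the monomial phase -/

/-- **The monomial phase is reached** if no prime divisor is followed forever: for some `K`, `J K = (ξ^α η^β)` for a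
regular system of parameters `(ξ, η)` of `R K`. With `N` such that `J k` is principal for `k ≥ N`: every prime divisor
of `R N` through which the chain passes is left after finitely many steps (hypothesis `hNF`), so for `K` large every
prime factor `π` of a generator of `J K` has `(R K)_{(π)}` dominating `R N` (otherwise its centre on `R N` is a prime
factor `π₁` of the generator of `J N` with `(R N)_{(π₁)} = (R K)_{(π)} ⊇ R K`), hence is `ξ` or `η` by
`exists_rsop_young`. [cite: ZariskiSamuel1960, Appendix 5] -/
theorem exists_monomial
    (hNF : ∀ (N : ℕ) (π : R N) (hπ : Prime π), ∃ k, N ≤ k ∧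
      ¬ (haveI := isPrime_span_of_prime hπ; R k ≤ (LocalSubring.ofPrime (R N) (Ideal.span {π})).toSubring)) :
    ∃ (K : ℕ) (ξ η : R K) (α β : ℕ), (haveI := (h.isRegularLocalRing K).toIsLocalRing; maximalIdeal (R K)) =
      Ideal.span {ξ, η} ∧ J K = Ideal.span {ξ ^ α * η ^ β} := by
  classical
  obtain ⟨N, hN⟩ := h.exists_forall_isPrincipal
  haveI := h.isRegularLocalRing N
  haveI : UniqueFactorizationMonoid (R N) := uniqueFactorizationMonoid_of_ringKrullDim_eq_two (h.ringKrullDim_eq_two N)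
  obtain ⟨u, hu⟩ := hN N le_rfl
  have hu' : J N = Ideal.span {u} := hu
  have hu0 : u ≠ 0 := by
    intro h0; apply h.ne_bot N; rw [hu', h0, Ideal.span_singleton_eq_bot]
  -- leaving stages for the prime factors of `u`
  have hleave : ∀ q : R N, q ∈ UniqueFactorizationMonoid.factors u → ∃ k, N ≤ k ∧
      ∀ hq : Prime q, ¬ (haveI := isPrime_span_of_prime hq;
        R k ≤ (LocalSubring.ofPrime (R N) (Ideal.span {q})).toSubring) := by
    intro q hq
    have hqp : Prime q := UniqueFactorizationMonoid.prime_of_factor q hq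
    obtain ⟨k, hk, hnot⟩ := hNF N q hqp
    exact ⟨k, hk, fun _ => hnot⟩
  choose! j hjN hj using hleave
  set K := (UniqueFactorizationMonoid.factors u).toFinset.sup j ⊔ N with hK
  have hNK : N ≤ K := le_sup_right
  have hjK : ∀ q ∈ UniqueFactorizationMonoid.factors u, j q ≤ K := fun q hq =>
    (Finset.le_sup (Multiset.mem_toFinset.mpr hq)).trans le_sup_left
  haveI := h.isRegularLocalRing K
  haveI : UniqueFactorizationMonoid (R K) := uniqueFactorizationMonoid_of_ringKrullDim_eq_two (h.ringKrullDim_eq_two K)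
  obtain ⟨uK, huK⟩ := hN K hNK
  have huK' : J K = Ideal.span {uK} := huK
  have huK0 : uK ≠ 0 := by
    intro h0; apply h.ne_bot K; rw [huK', h0, Ideal.span_singleton_eq_bot]
  obtain ⟨P, hP0, hP⟩ := h.exists_span_mul_eq_extIdeal_of_le hNK
  -- every prime factor of `uK` is young
  have hyoung : ∀ (π : R K) (hπ : Prime π), π ∣ uK → (haveI := isPrime_span_of_prime hπ;
      SubringDominates (R N) (LocalSubring.ofPrime (R K) (Ideal.span {π})).toSubring) := by
    intro π hπ hπu
    haveI := isPrime_span_of_prime hπ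
    by_contra hold
    have hle : R N ≤ (LocalSubring.ofPrime (R K) (Ideal.span {π})).toSubring :=
      (h.mono hNK).trans (LocalSubring.le_ofPrime _ _)
    -- a non-unit `z` of `R N` which is a unit of `(R K)_{(π)}`
    obtain ⟨z, hzN, hzinv, hzninv⟩ : ∃ z : F, z ∈ R N ∧ z⁻¹ ∈ (LocalSubring.ofPrime (R K) (Ideal.span {π})).toSubring ∧
        z⁻¹ ∉ R N := by
      by_contra hall
      push Not at hall
      exact hold ⟨hle, fun z hz hzi => hall z hz hzi⟩
    have hz0 : z ≠ 0 := by rintro rfl; exact hzninv (by rw [inv_zero]; exact (R N).zero_mem)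
    have hzm : (⟨z, hzN⟩ : R N) ∈ maximalIdeal (R N) := (mem_maximalIdeal_iff_inv_not_mem _).mpr (Or.inr hzninv)
    have hndvd : ¬ π ∣ Subring.inclusion (h.mono hNK) ⟨z, hzN⟩ := by
      intro hd
      have hz0' : Subring.inclusion (h.mono hNK) ⟨z, hzN⟩ ≠ 0 := fun e => hz0 (congrArg Subtype.val e)
      exact ((not_inv_mem_ofPrime_span_iff_dvd hπ hz0').mpr hd) hzinv
    obtain ⟨π₁, hπ₁, hc, hW⟩ := exists_prime_span_eq_comap (h.ringKrullDim_eq_two N) (h.isLocalRingOf' N).2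
      (h.mono hNK) hπ hzm hndvd
    haveI := isPrime_span_of_prime hπ₁
    -- `π₁ ∣ u`: `u R K = P · uK R K ⊆ (π)`
    have hπ₁u : π₁ ∣ u := by
      have hmem : Subring.inclusion (h.mono hNK) u ∈ Ideal.span {π} := by
        have h1 : Subring.inclusion (h.mono hNK) u ∈ extIdeal (J N) (R K) := by
          rw [extIdeal_eq_map _ (h.mono hNK)]; exact Ideal.mem_map_of_mem _ (hu' ▸ Ideal.mem_span_singleton_self u)
        rw [← hP, huK', Ideal.span_singleton_mul_span_singleton] at h1
        obtain ⟨c, hc'⟩ := Ideal.mem_span_singleton'.mp h1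
        rw [← hc']
        exact Ideal.mul_mem_left _ _ (Ideal.mul_mem_left _ _ (Ideal.mem_span_singleton.mpr hπu))
      have : u ∈ Ideal.span {π₁} := by rw [← hc, Ideal.mem_comap]; exact hmem
      exact Ideal.mem_span_singleton.mp this
    obtain ⟨q, hq, hassoc⟩ := UniqueFactorizationMonoid.exists_mem_factors_of_dvd hu0 hπ₁.irreducible hπ₁u
    have hqp : Prime q := UniqueFactorizationMonoid.prime_of_factor q hq
    haveI := isPrime_span_of_prime hqp
    have hspan : Ideal.span {π₁} = Ideal.span {q} := Ideal.span_singleton_eq_span_singleton.mpr hassoc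
    -- `(R N)_{(q)} = (R K)_{(π)} ⊇ R K ⊇ R (j q)`: contradiction
    have hle' : (LocalSubring.ofPrime (R N) (Ideal.span {q})).toSubring ≤
        (LocalSubring.ofPrime (R K) (Ideal.span {π})).toSubring := by
      rw [← ofPrime_span_congr hπ₁ hqp hspan]; exact hW
    have heq := eq_of_ofPrime_span_le hqp (h.isLocalRingOf' N).2 hle' (inv_not_mem_ofPrime_span hπ)
    apply hj q hq hqp
    calc R (j q) ≤ R K := h.mono (hjK q hq)
      _ ≤ (LocalSubring.ofPrime (R K) (Ideal.span {π})).toSubring := LocalSubring.le_ofPrime _ _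
      _ = _ := heq
  -- the young prime divisors are `ξ`, `η`
  obtain ⟨ξ, η, hm, hinv⟩ := h.exists_rsop_young N K hNK
  obtain ⟨α, β, ε, hε⟩ := exists_eq_unit_mul_pow_mul_pow huK0 fun π hπ hπu => hinv π hπ (hyoung π hπ hπu)
  refine ⟨K, ξ, η, α, β, hm, ?_⟩
  rw [huK', hε, mul_assoc, Ideal.span_singleton_mul_left_unit ε.isUnit]

/-- **The window in the monomial phase**: if `J K = (ξ^α η^β)` for a regular system of parameters `(ξ, η)` of `R K`
then `α < b` (isolated singular locus: `J K ⊄ (ξ^b)`) and `b ≤ α + β` (singular thread: `J K ⊆ 𝔪^b`). [folklore] -/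
theorem window {K : ℕ} {ξ η : R K} {α β : ℕ}
    (hm : (haveI := (h.isRegularLocalRing K).toIsLocalRing; maximalIdeal (R K)) = Ideal.span {ξ, η})
    (hJ : J K = Ideal.span {ξ ^ α * η ^ β}) : α < b ∧ b ≤ α + β := by
  haveI := h.isRegularLocalRing K
  have hdim := h.ringKrullDim_eq_two K
  obtain ⟨hξp, -⟩ := prime_of_span_pair hdim hm
  constructor
  · by_contra hge
    push Not at hge
    apply h.not_le_span_pow K ξ hξp ((maximalIdeal_ne_span_singleton hdim ξ).symm)
    rw [hJ, Ideal.span_singleton_le_span_singleton]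
    exact (pow_dvd_pow ξ hge).mul_right _
  · by_contra hlt
    push Not at hlt
    have hmem : ξ ^ α * η ^ β ∈ maximalIdeal (R K) ^ b :=
      h.le_pow K (by rw [hJ]; exact Ideal.mem_span_singleton_self _)
    have h1 : ξ ∉ maximalIdeal (R K) ^ 2 := fst_not_mem_sq hdim hm
    have h2 : η ∉ maximalIdeal (R K) ^ 2 := fst_not_mem_sq hdim (hm.trans Ideal.span_pair_comm)
    have hnot := unit_mul_pow_mul_pow_not_mem_pow h1 h2 1 α β
    rw [Units.val_one, one_mul] at hnot
    exact hnot (Ideal.pow_le_pow_right (by omega) hmem)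

/-- **The monomial form propagates with smaller total exponent** (oriented: `ν(η) ≤ ν(ξ)` in multiplicative notation):
from `J K = (ξ^α η^β)`, `β < b ≤ α + β`, the transform law and `mono_step_of_le` give `J (K+1) = (ξ'^{α'} η'^{β'})`
for a regular system of parameters of `R (K+1)` with `α' + β' < α + β`. [cite: ZariskiSamuel1960, Appendix 5] -/
theorem mono_succ {O : ValuationSubring F} (hO : ∀ k, SubringDominates (R k) O.toSubring) {K : ℕ} {ξ η : R K}
    {α β : ℕ} (hm : (haveI := (h.isRegularLocalRing K).toIsLocalRing; maximalIdeal (R K)) = Ideal.span {ξ, η})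
    (hJ : J K = Ideal.span {ξ ^ α * η ^ β}) (hle : O.valuation (η : F) ≤ O.valuation (ξ : F)) (hβb : β < b)
    (hsum : b ≤ α + β) :
    ∃ (ξ' η' : R (K + 1)) (α' β' : ℕ),
      (haveI := (h.isRegularLocalRing (K + 1)).toIsLocalRing; maximalIdeal (R (K + 1))) = Ideal.span {ξ', η'} ∧
      α' + β' < α + β ∧ J (K + 1) = Ideal.span {ξ' ^ α' * η' ^ β'} := by
  haveI := h.isRegularLocalRing K
  haveI := h.isRegularLocalRing (K + 1)
  have hdim := h.ringKrullDim_eq_two K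
  have hξ0 : (ξ : F) ≠ 0 := fun e => (prime_of_span_pair hdim hm).1.ne_zero (Subtype.ext e)
  obtain ⟨hξ1, ξ', η', α', β', hm₁, hlt, hmx, hprod⟩ :=
    mono_step_of_le hdim (h.along hO K) (hO K) (hO (K + 1)) hm hle h.b_pos hβb hsum
  refine ⟨ξ', η', α', β', hm₁, hlt, ?_⟩
  have h1 := h.span_pow_mul_eq K hξ1 hmx
  rw [hJ, ← hprod] at h1
  have hX0 : (⟨(ξ : F), hξ1⟩ : R (K + 1)) ^ b ≠ 0 :=
    pow_ne_zero _ fun e => hξ0 (congrArg Subtype.val e)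
  exact (Ideal.span_singleton_mul_right_inj hX0).mp h1

/-- **Descent in the monomial phase.** If `J K = (ξ^α η^β)` for a regular system of parameters `(ξ, η)` of `R K`, the
chain is impossible: `window` gives `α, β < b ≤ α + β`, and `mono_succ` reproduces the monomial form at `K + 1` with
strictly smaller `α + β`. [cite: ZariskiSamuel1960, Appendix 5] -/
theorem false_of_monomial : ∀ (n : ℕ) (K : ℕ) (ξ η : R K) (α β : ℕ), α + β = n →
    (haveI := (h.isRegularLocalRing K).toIsLocalRing; maximalIdeal (R K)) = Ideal.span {ξ, η} →
    J K = Ideal.span {ξ ^ α * η ^ β} → False := by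
  obtain ⟨O, hO⟩ := h.exists_valuationSubring
  intro n
  induction n using Nat.strong_induction_on with
  | _ n ih =>
  intro K ξ η α β hn hm hJ
  haveI := h.isRegularLocalRing K
  have hm' : maximalIdeal (R K) = Ideal.span {η, ξ} := hm.trans Ideal.span_pair_comm
  have hJ' : J K = Ideal.span {η ^ β * ξ ^ α} := by rw [hJ, mul_comm]
  obtain ⟨hαb, hsum⟩ := h.window hm hJ
  obtain ⟨hβb, -⟩ := h.window hm' hJ'
  rcases le_total (O.valuation (η : F)) (O.valuation (ξ : F)) with hle | hle
  · obtain ⟨ξ', η', α', β', hm₁, hlt, hJ₁⟩ := h.mono_succ hO hm hJ hle hβb hsum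
    exact ih (α' + β') (hn ▸ hlt) (K + 1) ξ' η' α' β' rfl hm₁ hJ₁
  · obtain ⟨ξ', η', α', β', hm₁, hlt, hJ₁⟩ := h.mono_succ hO hm' hJ' hle hαb (by omega)
    exact ih (α' + β') (by omega) (K + 1) ξ' η' α' β' rfl hm₁ hJ₁

/-- **The exceptional end game.** A thread chain in which no prime divisor is followed forever — for every prime
element `π` of every `R N` the chain eventually leaves `(R N)_{(π)}` — is impossible. [cite: ZariskiSamuel1960, Appendix 5] -/
theorem false_of_forall_exists_not_le
    (hNF : ∀ (N : ℕ) (π : R N) (hπ : Prime π), ∃ k, N ≤ k ∧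
      ¬ (haveI := isPrime_span_of_prime hπ; R k ≤ (LocalSubring.ofPrime (R N) (Ideal.span {π})).toSubring)) :
    False := by
  obtain ⟨K, ξ, η, α, β, hm, hJ⟩ := h.exists_monomial hNF
  exact h.false_of_monomial (α + β) K ξ η α β rfl hm hJ

end IsThreadChain

end CampaignW46

end Summit.ResolutionOfSingularities.ResolutionOfSingularities.Theorems

end
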